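import Mathlib
import HarnessLib
import Summits.Ventures.LatticeQCDFlow.Exactness.SUNMultiStepLeapfrogHMC
import Summits.Ventures.LatticeQCDFlow.Exactness.SUNLeapfrogHMCEngine

/-!
# Moments of the ENGINE'S `SU(N)` Gaussian refresh `Z⁻¹e^{−sunKinetic}·addHaar^{⊗links}` (kinetic term `−Σ tr P²` in the coordinates `sunCoordι N`): `E‖p_l‖² ≤ 2^{D/2}`, `E‖p_l‖ ≤ (1 + 2^{D/2})/2`, `EΣ_l‖p_l‖ ≤ |L|(1 + 2^{D/2})/2`, `E(Σ_l‖p_l‖)² ≤ |L|²·2^{D/2}` (`D = dim SUNCoords N`; sup norm; explicit, not optimised)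

HONEST FRAMING: exact (Metropolis-corrected) sampling algorithms for lattice gauge theory;
figures of merit are autocorrelation/cost numbers at stated couplings and volumes; no
continuum-physics claim.

Venture `LatticeQCDFlow` (cell pub-lqcd), topic `Exactness`; FANOUT row 14 (`eng-flowhmc`, family B) serving row 21 (the
engine's `SU(3)` Wilson HMC: the pointwise energy-error law of `SUNEngineWilsonEnergyError` is a polynomial in `‖p‖`,
`Σ_l‖p_l‖`; its refresh average needs these moments).  NEW WORK of the cell over row 9's `SUNLeapfrogHMC` /
`SUNLeapfrogHMCEngine` (`sunMomentumWeight`, `sunMomentumLaw`, `sunCoordQuad = −tr P²` on `SUNCoords N` with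
`‖c‖² ≤ q(c)`, `sunKinetic N p = Σ_l q(p_l)`, `lintegral_exp_neg_sunCoordQuad_lt_top`, `StdGaussianRadial.lintegral_prod_pi`)
and Mathlib (`Measure.integral_comp_smul`: scaling under an additive Haar measure); nothing is cited as a fact; no number.
WHY NOT `SUNMomentumLawMoments`: that file's law is `e^{−κΣ‖p_l‖²}` for the norm of the coordinate space; `SUNCoords N`
carries the product SUP norm, in which `−tr P²` is a quadratic form but not `‖·‖²`.  Here the bounds come from
`‖c‖² ≤ q(c)`, `x ≤ e^{x/2}` and the scaling `∫ e^{−q/2} = 2^{D/2}∫ e^{−q}` — crude (exponential in `D = N² − 1`) but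
explicit; the exact values (`E q(p_l) = D/2`) are NOT claimed.

* §1 (one link) `sunCoordQuad_smul` (`q(s•c) = s²q(c)`), `integrable_exp_neg_sunCoordQuad`,
  `integral_exp_neg_sunCoordQuad_pos`, `integral_exp_neg_half_sunCoordQuad` (`∫ e^{−q/2}dμ = (√2)^D ∫ e^{−q}dμ`),
  `norm_sq_mul_exp_neg_sunCoordQuad_le` (`‖c‖²e^{−q} ≤ e^{−q/2}`, via `x ≤ e^{x/2}`),
  `norm_mul_exp_neg_sunCoordQuad_le` (`‖c‖e^{−q} ≤ (e^{−q} + e^{−q/2})/2`), integrability of both, and the two moment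
  bounds `integral_norm_sq_mul_exp_neg_sunCoordQuad_le` / `integral_norm_mul_exp_neg_sunCoordQuad_le`.
* §2 (the product law `sunMomentumLaw μ (sunKinetic N)`) `sunMomentumWeight_sunKinetic_univ` (`Z = (∫e^{−q})^{|L|}`),
  `isProbabilityMeasure_sunMomentumLaw_sunKinetic`, **`lintegral_apply_sunMomentumWeight_sunKinetic`** (Tonelli for a one-link
  observable), **`integral_apply_sunMomentumLaw_sunKinetic`** (`E φ(p_l) = ∫φe^{−q}/∫e^{−q}`), `integrable_apply_sunMomentumLaw_sunKinetic`,
  **`integral_norm_apply_sq_sunKineticLaw_le`**, **`integral_norm_apply_sunKineticLaw_le`**, **`integral_sum_norm_sunKineticLaw_le`**,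
  **`integral_sq_sum_norm_sunKineticLaw_le`**, and the integrability of `Σ_l‖p_l‖`, `(Σ_l‖p_l‖)²`.

NOT CLAIMED: exact moments; sharp constants; anything about the configuration marginal; any number beyond these bounds.
-/

noncomputable section

namespace Summit.Ventures.LatticeQCDFlow.Exactness

open Set MeasureTheory
open scoped ENNReal

set_option backward.isDefEq.respectTransparency false

/-! ## §1 One link: the Gaussian `e^{−q}` on `SUNCoords N` -/

section OneLink

variable (N : ℕ) (μ : Measure (SUNCoords N)) [μ.IsAddHaarMeasure]

omit [μ.IsAddHaarMeasure] in
/-- The kinetic quadratic form is homogeneous of degree two: `q(s•c) = s²·q(c)`. -/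
theorem sunCoordQuad_smul (s : ℝ) (c : SUNCoords N) : sunCoordQuad N (s • c) = s ^ 2 * sunCoordQuad N c := by
  unfold sunCoordQuad
  simp only [Prod.smul_fst, Prod.smul_snd, Submodule.coe_smul, Pi.smul_apply, smul_eq_mul]
  have h1 : ∑ i, (s * (c.1 : Fin N → ℝ) i) ^ 2 = s ^ 2 * ∑ i, ((c.1 : Fin N → ℝ) i) ^ 2 := by
    rw [Finset.mul_sum]; exact Finset.sum_congr rfl fun i _ => by ring
  have h2 : ∑ p, ((s * c.2.1 p) ^ 2 + (s * c.2.2 p) ^ 2) = s ^ 2 * ∑ p, ((c.2.1 p) ^ 2 + (c.2.2 p) ^ 2) := by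
    rw [Finset.mul_sum]; exact Finset.sum_congr rfl fun p _ => by ring
  rw [h1, h2]
  ring

/-- `e^{−q}` is integrable. -/
theorem integrable_exp_neg_sunCoordQuad : Integrable (fun c : SUNCoords N => Real.exp (-sunCoordQuad N c)) μ := by
  refine ⟨((continuous_sunCoordQuad N).neg.rexp).aestronglyMeasurable,
    (hasFiniteIntegral_iff_ofReal (Filter.Eventually.of_forall fun c => (Real.exp_pos _).le)).2 ?_⟩
  exact lintegral_exp_neg_sunCoordQuad_lt_top N μ

/-- `∫ e^{−q} dμ > 0`. -/
theorem integral_exp_neg_sunCoordQuad_pos : 0 < ∫ c, Real.exp (-sunCoordQuad N c) ∂μ := by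
  rw [integral_pos_iff_support_of_nonneg (fun c => (Real.exp_pos _).le) (integrable_exp_neg_sunCoordQuad N μ)]
  have hsupp : Function.support (fun c : SUNCoords N => Real.exp (-sunCoordQuad N c)) = Set.univ :=
    Function.support_eq_univ (fun c => (Real.exp_pos _).ne')
  rw [hsupp]
  exact (isOpen_univ.measure_pos μ univ_nonempty)

/-- **Scaling**: `∫ e^{−q(c)/2} dμ = (√2)^D · ∫ e^{−q} dμ`, `D = dim SUNCoords N`. -/
theorem integral_exp_neg_half_sunCoordQuad :
    ∫ c, Real.exp (-(sunCoordQuad N c / 2)) ∂μ =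
      Real.sqrt 2 ^ Module.finrank ℝ (SUNCoords N) * ∫ c, Real.exp (-sunCoordQuad N c) ∂μ := by
  have hs : ∀ c : SUNCoords N, Real.exp (-(sunCoordQuad N c / 2)) = Real.exp (-sunCoordQuad N ((Real.sqrt 2)⁻¹ • c)) := by
    intro c
    rw [sunCoordQuad_smul, inv_pow, Real.sq_sqrt (by norm_num : (0 : ℝ) ≤ 2)]
    ring_nf
  simp_rw [hs]
  rw [Measure.integral_comp_smul μ (fun c => Real.exp (-sunCoordQuad N c)) (Real.sqrt 2)⁻¹, smul_eq_mul, inv_pow, inv_inv,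
    abs_of_nonneg (by positivity)]

omit [μ.IsAddHaarMeasure] in
/-- `‖c‖²e^{−q(c)} ≤ e^{−q(c)/2}` (`‖c‖² ≤ q(c)` and `q e^{−q/2} ≤ 1`). -/
theorem norm_sq_mul_exp_neg_sunCoordQuad_le (c : SUNCoords N) :
    ‖c‖ ^ 2 * Real.exp (-sunCoordQuad N c) ≤ Real.exp (-(sunCoordQuad N c / 2)) := by
  have hq := sunCoordQuad_nonneg N c
  have hn := norm_sq_le_sunCoordQuad N c
  -- `x ≤ e^{x/2}` for `x ≥ 0` (`x ≤ (1 + x/4)² ≤ (e^{x/4})²`; the same elementary fact serves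
  -- `Literature.NumberTheory.Automorphic.SelbergDecay.le_exp_half`, not imported here)
  have hle : sunCoordQuad N c ≤ Real.exp (sunCoordQuad N c / 2) := by
    have h1 : sunCoordQuad N c ≤ (sunCoordQuad N c / 4 + 1) ^ 2 := by nlinarith [sq_nonneg (1 - sunCoordQuad N c / 4)]
    have h2 : sunCoordQuad N c / 4 + 1 ≤ Real.exp (sunCoordQuad N c / 4) := Real.add_one_le_exp _
    have h3 : (sunCoordQuad N c / 4 + 1) ^ 2 ≤ Real.exp (sunCoordQuad N c / 4) ^ 2 := pow_le_pow_left₀ (by linarith) h2 2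
    have h4 : Real.exp (sunCoordQuad N c / 4) ^ 2 = Real.exp (sunCoordQuad N c / 2) := by rw [← Real.exp_nat_mul]; ring_nf
    linarith [h4 ▸ h3]
  have hsplit : Real.exp (-sunCoordQuad N c) = Real.exp (-(sunCoordQuad N c / 2)) * Real.exp (-(sunCoordQuad N c / 2)) := by
    rw [← Real.exp_add]; ring_nf
  have hprod : sunCoordQuad N c * Real.exp (-(sunCoordQuad N c / 2)) ≤ 1 := by
    rw [Real.exp_neg]
    have hpos := Real.exp_pos (sunCoordQuad N c / 2)
    rw [mul_inv_le_iff₀ hpos, one_mul]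
    exact hle
  calc ‖c‖ ^ 2 * Real.exp (-sunCoordQuad N c) ≤ sunCoordQuad N c * Real.exp (-sunCoordQuad N c) :=
        mul_le_mul_of_nonneg_right hn (Real.exp_pos _).le
    _ = (sunCoordQuad N c * Real.exp (-(sunCoordQuad N c / 2))) * Real.exp (-(sunCoordQuad N c / 2)) := by rw [hsplit, mul_assoc]
    _ ≤ 1 * Real.exp (-(sunCoordQuad N c / 2)) := mul_le_mul_of_nonneg_right hprod (Real.exp_pos _).le
    _ = Real.exp (-(sunCoordQuad N c / 2)) := one_mul _

omit [μ.IsAddHaarMeasure] in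
/-- `‖c‖e^{−q(c)} ≤ (e^{−q(c)} + e^{−q(c)/2})/2` (`2‖c‖ ≤ 1 + ‖c‖²`). -/
theorem norm_mul_exp_neg_sunCoordQuad_le (c : SUNCoords N) :
    ‖c‖ * Real.exp (-sunCoordQuad N c) ≤ (Real.exp (-sunCoordQuad N c) + Real.exp (-(sunCoordQuad N c / 2))) / 2 := by
  have h := norm_sq_mul_exp_neg_sunCoordQuad_le N c
  have hpos := (Real.exp_pos (-sunCoordQuad N c)).le
  have ham : ‖c‖ ≤ (1 + ‖c‖ ^ 2) / 2 := by nlinarith [sq_nonneg (‖c‖ - 1)]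
  calc ‖c‖ * Real.exp (-sunCoordQuad N c) ≤ (1 + ‖c‖ ^ 2) / 2 * Real.exp (-sunCoordQuad N c) :=
        mul_le_mul_of_nonneg_right ham hpos
    _ = (Real.exp (-sunCoordQuad N c) + ‖c‖ ^ 2 * Real.exp (-sunCoordQuad N c)) / 2 := by ring
    _ ≤ (Real.exp (-sunCoordQuad N c) + Real.exp (-(sunCoordQuad N c / 2))) / 2 := by linarith

/-- `e^{−q/2}` is integrable. -/
theorem integrable_exp_neg_half_sunCoordQuad : Integrable (fun c : SUNCoords N => Real.exp (-(sunCoordQuad N c / 2))) μ := by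
  have h := (integrable_exp_neg_sunCoordQuad N μ).comp_smul (inv_ne_zero (Real.sqrt_ne_zero'.2 (by norm_num : (0:ℝ) < 2)))
  refine h.congr (Filter.Eventually.of_forall fun c => ?_)
  simp only
  rw [sunCoordQuad_smul, inv_pow, Real.sq_sqrt (by norm_num : (0 : ℝ) ≤ 2)]
  ring_nf

/-- `‖c‖²e^{−q}` is integrable. -/
theorem integrable_norm_sq_mul_exp_neg_sunCoordQuad :
    Integrable (fun c : SUNCoords N => ‖c‖ ^ 2 * Real.exp (-sunCoordQuad N c)) μ :=
  (integrable_exp_neg_half_sunCoordQuad N μ).mono' ((continuous_norm.pow 2).mul (continuous_sunCoordQuad N).neg.rexp).aestronglyMeasurable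
    (Filter.Eventually.of_forall fun c => by
      rw [Real.norm_eq_abs, abs_of_nonneg (by positivity)]
      exact norm_sq_mul_exp_neg_sunCoordQuad_le N c)

/-- `‖c‖e^{−q}` is integrable. -/
theorem integrable_norm_mul_exp_neg_sunCoordQuad :
    Integrable (fun c : SUNCoords N => ‖c‖ * Real.exp (-sunCoordQuad N c)) μ :=
  (((integrable_exp_neg_sunCoordQuad N μ).add (integrable_exp_neg_half_sunCoordQuad N μ)).div_const 2).mono'
    (continuous_norm.mul (continuous_sunCoordQuad N).neg.rexp).aestronglyMeasurable
    (Filter.Eventually.of_forall fun c => by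
      rw [Real.norm_eq_abs, abs_of_nonneg (by positivity)]
      exact norm_mul_exp_neg_sunCoordQuad_le N c)

/-- **Second moment bound**: `∫ ‖c‖²e^{−q} dμ ≤ (√2)^D · ∫ e^{−q} dμ`. -/
theorem integral_norm_sq_mul_exp_neg_sunCoordQuad_le :
    ∫ c, ‖c‖ ^ 2 * Real.exp (-sunCoordQuad N c) ∂μ ≤
      Real.sqrt 2 ^ Module.finrank ℝ (SUNCoords N) * ∫ c, Real.exp (-sunCoordQuad N c) ∂μ := by
  rw [← integral_exp_neg_half_sunCoordQuad N μ]
  exact integral_mono (integrable_norm_sq_mul_exp_neg_sunCoordQuad N μ) (integrable_exp_neg_half_sunCoordQuad N μ)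
    (norm_sq_mul_exp_neg_sunCoordQuad_le N)

/-- **First moment bound**: `∫ ‖c‖e^{−q} dμ ≤ ((1 + (√2)^D)/2) · ∫ e^{−q} dμ`. -/
theorem integral_norm_mul_exp_neg_sunCoordQuad_le :
    ∫ c, ‖c‖ * Real.exp (-sunCoordQuad N c) ∂μ ≤
      (1 + Real.sqrt 2 ^ Module.finrank ℝ (SUNCoords N)) / 2 * ∫ c, Real.exp (-sunCoordQuad N c) ∂μ := by
  have h := integral_mono (integrable_norm_mul_exp_neg_sunCoordQuad N μ)
    (((integrable_exp_neg_sunCoordQuad N μ).add (integrable_exp_neg_half_sunCoordQuad N μ)).div_const 2)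
    (norm_mul_exp_neg_sunCoordQuad_le N)
  refine h.trans (le_of_eq ?_)
  rw [integral_div, integral_add' (integrable_exp_neg_sunCoordQuad N μ) (integrable_exp_neg_half_sunCoordQuad N μ),
    integral_exp_neg_half_sunCoordQuad N μ]
  ring

end OneLink

/-! ## §2 The engine's refresh law `sunMomentumLaw μ (sunKinetic N)` on `SUNCoords^L` -/

section Product

variable (N : ℕ) (μ : Measure (SUNCoords N)) [μ.IsAddHaarMeasure] {L : Type*} [Fintype L]

/-- **The mass of the engine's momentum weight**: `Z = (∫ e^{−q} dμ)^{|L|}` (Tonelli). -/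
theorem sunMomentumWeight_sunKinetic_univ :
    sunMomentumWeight (L := L) μ (sunKinetic N) univ =
      ENNReal.ofReal (∫ c, Real.exp (-sunCoordQuad N c) ∂μ) ^ Fintype.card L := by
  have hmeas1 : Measurable fun c : SUNCoords N => ENNReal.ofReal (Real.exp (-sunCoordQuad N c)) :=
    (Real.measurable_exp.comp (continuous_sunCoordQuad N).measurable.neg).ennreal_ofReal
  have h1 : ∀ p : L → SUNCoords N, ENNReal.ofReal (Real.exp (-sunKinetic N p)) =
      ∏ l, ENNReal.ofReal (Real.exp (-sunCoordQuad N (p l))) := fun p => by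
    rw [← ENNReal.ofReal_prod_of_nonneg (fun l _ => (Real.exp_pos _).le), ← Real.exp_sum]
    congr 1
    rw [sunKinetic, ← Finset.sum_neg_distrib]
  rw [sunMomentumWeight, withDensity_apply _ MeasurableSet.univ, Measure.restrict_univ]
  simp_rw [h1]
  rw [lintegral_prod_pi (fun _ : L => μ) (fun _ => hmeas1), Finset.prod_const, Finset.card_univ,
    ← ofReal_integral_eq_lintegral_ofReal (integrable_exp_neg_sunCoordQuad N μ)
      (Filter.Eventually.of_forall fun v => (Real.exp_pos _).le)]

/-- The engine's refresh law is a probability law. -/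
theorem isProbabilityMeasure_sunMomentumLaw_sunKinetic : IsProbabilityMeasure (sunMomentumLaw (L := L) μ (sunKinetic N)) :=
  isProbabilityMeasure_sunMomentumLaw μ _ (measurable_sunKinetic N) (sunMomentumWeight_sunKinetic_ne_top N μ)

/-- **Tonelli over the links for a one-link observable** `φ ≥ 0` with `φ·e^{−q}` integrable:
`∫ φ(p_l) e^{−T(p)} dμ^{⊗L} = (∫ φ e^{−q}dμ)·(∫ e^{−q}dμ)^{|L|−1}`. -/
theorem lintegral_apply_sunMomentumWeight_sunKinetic {φ : SUNCoords N → ℝ} (hφ0 : ∀ c, 0 ≤ φ c) (hφm : Measurable φ)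
    (hφi : Integrable (fun c => φ c * Real.exp (-sunCoordQuad N c)) μ) (l : L) :
    ∫⁻ p, ENNReal.ofReal (φ (p l)) ∂(sunMomentumWeight (L := L) μ (sunKinetic N)) =
      ENNReal.ofReal (∫ c, φ c * Real.exp (-sunCoordQuad N c) ∂μ) *
        ENNReal.ofReal (∫ c, Real.exp (-sunCoordQuad N c) ∂μ) ^ (Fintype.card L - 1) := by
  classical
  have hmw : Measurable fun c : SUNCoords N => ENNReal.ofReal (Real.exp (-sunCoordQuad N c)) :=
    (Real.measurable_exp.comp (continuous_sunCoordQuad N).measurable.neg).ennreal_ofReal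
  have hmk : Measurable fun c : SUNCoords N => ENNReal.ofReal (φ c * Real.exp (-sunCoordQuad N c)) :=
    (hφm.mul (Real.measurable_exp.comp (continuous_sunCoordQuad N).measurable.neg)).ennreal_ofReal
  set F : L → SUNCoords N → ℝ≥0∞ := fun m c =>
    if m = l then ENNReal.ofReal (φ c * Real.exp (-sunCoordQuad N c)) else ENNReal.ofReal (Real.exp (-sunCoordQuad N c)) with hF
  have hFm : ∀ m, Measurable (F m) := by
    intro m
    by_cases hm : m = l
    · simp only [hF, hm, if_true]; exact hmk
    · simp only [hF, hm, if_false]; exact hmw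
  have hdens : ∀ p : L → SUNCoords N,
      ENNReal.ofReal (Real.exp (-sunKinetic N p)) * ENNReal.ofReal (φ (p l)) = ∏ m, F m (p m) := by
    intro p
    have h1 : ENNReal.ofReal (Real.exp (-sunKinetic N p)) = ∏ m, ENNReal.ofReal (Real.exp (-sunCoordQuad N (p m))) := by
      rw [← ENNReal.ofReal_prod_of_nonneg (fun m _ => (Real.exp_pos _).le), ← Real.exp_sum]
      congr 1
      rw [sunKinetic, ← Finset.sum_neg_distrib]
    rw [h1, ← Finset.mul_prod_erase Finset.univ (fun m => ENNReal.ofReal (Real.exp (-sunCoordQuad N (p m)))) (Finset.mem_univ l),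
      ← Finset.mul_prod_erase Finset.univ (fun m => F m (p m)) (Finset.mem_univ l)]
    have hl : F l (p l) = ENNReal.ofReal (φ (p l) * Real.exp (-sunCoordQuad N (p l))) := by simp only [hF, if_true]
    have hrest : ∏ m ∈ Finset.univ.erase l, F m (p m) = ∏ m ∈ Finset.univ.erase l, ENNReal.ofReal (Real.exp (-sunCoordQuad N (p m))) := by
      refine Finset.prod_congr rfl fun m hm => ?_
      have hml : m ≠ l := Finset.ne_of_mem_erase hm
      simp only [hF, hml, if_false]
    rw [hl, hrest, ENNReal.ofReal_mul (hφ0 _)]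
    ring
  have hmd : Measurable (fun p : L → SUNCoords N => ENNReal.ofReal (Real.exp (-sunKinetic N p))) :=
    (Real.measurable_exp.comp (measurable_sunKinetic N).neg).ennreal_ofReal
  have hmφ : Measurable (fun p : L → SUNCoords N => ENNReal.ofReal (φ (p l))) := (hφm.comp (measurable_pi_apply l)).ennreal_ofReal
  rw [sunMomentumWeight, lintegral_withDensity_eq_lintegral_mul _ hmd hmφ]
  have hfun : ((fun p : L → SUNCoords N => ENNReal.ofReal (Real.exp (-sunKinetic N p))) *
      fun p => ENNReal.ofReal (φ (p l))) = fun p => ∏ m, F m (p m) := by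
    funext p
    exact hdens p
  rw [hfun, lintegral_prod_pi (fun _ : L => μ) hFm, ← Finset.mul_prod_erase Finset.univ (fun m => ∫⁻ v, F m v ∂μ) (Finset.mem_univ l)]
  have hl : ∫⁻ v, F l v ∂μ = ENNReal.ofReal (∫ c, φ c * Real.exp (-sunCoordQuad N c) ∂μ) := by
    simp only [hF, if_true]
    rw [← ofReal_integral_eq_lintegral_ofReal hφi
      (Filter.Eventually.of_forall fun c => mul_nonneg (hφ0 c) (Real.exp_pos _).le)]
  have hrest : ∏ m ∈ Finset.univ.erase l, ∫⁻ v, F m v ∂μ =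
      ENNReal.ofReal (∫ c, Real.exp (-sunCoordQuad N c) ∂μ) ^ (Fintype.card L - 1) := by
    rw [← Finset.card_univ, ← Finset.card_erase_of_mem (Finset.mem_univ l), ← Finset.prod_const]
    refine Finset.prod_congr rfl fun m hm => ?_
    have hml : m ≠ l := Finset.ne_of_mem_erase hm
    simp only [hF, hml, if_false]
    rw [← ofReal_integral_eq_lintegral_ofReal (integrable_exp_neg_sunCoordQuad N μ)
      (Filter.Eventually.of_forall fun v => (Real.exp_pos _).le)]
  rw [hl, hrest]

/-- **One-link expectations under the engine's refresh law**: `E φ(p_l) = (∫ φe^{−q}dμ)/(∫ e^{−q}dμ)`. -/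
theorem integral_apply_sunMomentumLaw_sunKinetic {φ : SUNCoords N → ℝ} (hφ0 : ∀ c, 0 ≤ φ c) (hφm : Measurable φ)
    (hφi : Integrable (fun c => φ c * Real.exp (-sunCoordQuad N c)) μ) (l : L) :
    ∫ p, φ (p l) ∂(sunMomentumLaw (L := L) μ (sunKinetic N)) =
      (∫ c, φ c * Real.exp (-sunCoordQuad N c) ∂μ) / ∫ c, Real.exp (-sunCoordQuad N c) ∂μ := by
  have hJ0 := integral_exp_neg_sunCoordQuad_pos N μ
  have hJk : 0 ≤ ∫ c, φ c * Real.exp (-sunCoordQuad N c) ∂μ := integral_nonneg fun c => mul_nonneg (hφ0 c) (Real.exp_pos _).le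
  have hmeas : Measurable fun p : L → SUNCoords N => φ (p l) := hφm.comp (measurable_pi_apply l)
  rw [integral_eq_lintegral_of_nonneg_ae (Filter.Eventually.of_forall fun p => hφ0 _) hmeas.aestronglyMeasurable,
    sunMomentumLaw, lintegral_smul_measure, lintegral_apply_sunMomentumWeight_sunKinetic N μ hφ0 hφm hφi l,
    sunMomentumWeight_sunKinetic_univ N μ, smul_eq_mul]
  rw [ENNReal.toReal_mul, ENNReal.toReal_mul, ENNReal.toReal_inv, ENNReal.toReal_pow, ENNReal.toReal_pow,
    ENNReal.toReal_ofReal hJk, ENNReal.toReal_ofReal hJ0.le]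
  set A := ∫ c, Real.exp (-sunCoordQuad N c) ∂μ with hA
  set J := ∫ c, φ c * Real.exp (-sunCoordQuad N c) ∂μ with hJ
  have hc : Fintype.card L = (Fintype.card L - 1) + 1 :=
    (Nat.succ_pred_eq_of_pos (Fintype.card_pos_iff.2 ⟨l⟩)).symm
  have hAne : A ≠ 0 := hJ0.ne'
  have hAc : A ^ (Fintype.card L - 1) ≠ 0 := pow_ne_zero _ hAne
  rw [hc, pow_succ, Nat.add_sub_cancel]
  field_simp

/-- One-link observables with `φe^{−q}` integrable are integrable under the refresh law. -/
theorem integrable_apply_sunMomentumLaw_sunKinetic {φ : SUNCoords N → ℝ} (hφ0 : ∀ c, 0 ≤ φ c) (hφm : Measurable φ)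
    (hφi : Integrable (fun c => φ c * Real.exp (-sunCoordQuad N c)) μ) (l : L) :
    Integrable (fun p : L → SUNCoords N => φ (p l)) (sunMomentumLaw (L := L) μ (sunKinetic N)) := by
  have hmeas : Measurable fun p : L → SUNCoords N => φ (p l) := hφm.comp (measurable_pi_apply l)
  refine ⟨hmeas.aestronglyMeasurable, (hasFiniteIntegral_iff_ofReal (Filter.Eventually.of_forall fun p => hφ0 _)).2 ?_⟩
  rw [sunMomentumLaw, lintegral_smul_measure, lintegral_apply_sunMomentumWeight_sunKinetic N μ hφ0 hφm hφi l, smul_eq_mul]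
  refine ENNReal.mul_lt_top ?_ ?_
  · exact ENNReal.inv_lt_top.2 (pos_iff_ne_zero.2 (sunMomentumWeight_univ_ne_zero μ _ (measurable_sunKinetic N)))
  · exact ENNReal.mul_lt_top ENNReal.ofReal_lt_top (ENNReal.pow_lt_top ENNReal.ofReal_lt_top)

/-- **`E ‖p_l‖² ≤ (√2)^D`** under the engine's refresh law. -/
theorem integral_norm_apply_sq_sunKineticLaw_le (l : L) :
    ∫ p, ‖p l‖ ^ 2 ∂(sunMomentumLaw (L := L) μ (sunKinetic N)) ≤ Real.sqrt 2 ^ Module.finrank ℝ (SUNCoords N) := by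
  rw [integral_apply_sunMomentumLaw_sunKinetic N μ (φ := fun c => ‖c‖ ^ 2) (fun _ => by positivity)
    (measurable_norm.pow_const 2) (integrable_norm_sq_mul_exp_neg_sunCoordQuad N μ) l,
    div_le_iff₀ (integral_exp_neg_sunCoordQuad_pos N μ)]
  exact integral_norm_sq_mul_exp_neg_sunCoordQuad_le N μ

/-- **`E ‖p_l‖ ≤ (1 + (√2)^D)/2`** under the engine's refresh law. -/
theorem integral_norm_apply_sunKineticLaw_le (l : L) :
    ∫ p, ‖p l‖ ∂(sunMomentumLaw (L := L) μ (sunKinetic N)) ≤ (1 + Real.sqrt 2 ^ Module.finrank ℝ (SUNCoords N)) / 2 := by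
  rw [integral_apply_sunMomentumLaw_sunKinetic N μ (φ := fun c => ‖c‖) (fun _ => norm_nonneg _)
    measurable_norm (integrable_norm_mul_exp_neg_sunCoordQuad N μ) l,
    div_le_iff₀ (integral_exp_neg_sunCoordQuad_pos N μ)]
  exact integral_norm_mul_exp_neg_sunCoordQuad_le N μ

/-- `‖p_l‖` is integrable under the engine's refresh law. -/
theorem integrable_norm_apply_sunKineticLaw (l : L) :
    Integrable (fun p : L → SUNCoords N => ‖p l‖) (sunMomentumLaw (L := L) μ (sunKinetic N)) :=
  integrable_apply_sunMomentumLaw_sunKinetic N μ (φ := fun c => ‖c‖) (fun _ => norm_nonneg _) measurable_norm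
    (integrable_norm_mul_exp_neg_sunCoordQuad N μ) l

/-- `‖p_l‖²` is integrable under the engine's refresh law. -/
theorem integrable_norm_apply_sq_sunKineticLaw (l : L) :
    Integrable (fun p : L → SUNCoords N => ‖p l‖ ^ 2) (sunMomentumLaw (L := L) μ (sunKinetic N)) :=
  integrable_apply_sunMomentumLaw_sunKinetic N μ (φ := fun c => ‖c‖ ^ 2) (fun _ => by positivity) (measurable_norm.pow_const 2)
    (integrable_norm_sq_mul_exp_neg_sunCoordQuad N μ) l

/-- **`E Σ_l‖p_l‖ ≤ |L|·(1 + (√2)^D)/2`**. -/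
theorem integral_sum_norm_sunKineticLaw_le :
    ∫ p, ∑ l, ‖p l‖ ∂(sunMomentumLaw (L := L) μ (sunKinetic N)) ≤
      Fintype.card L * ((1 + Real.sqrt 2 ^ Module.finrank ℝ (SUNCoords N)) / 2) := by
  rw [integral_finsetSum _ fun l _ => integrable_norm_apply_sunKineticLaw N μ l]
  calc ∑ l, ∫ p, ‖p l‖ ∂(sunMomentumLaw (L := L) μ (sunKinetic N))
      ≤ ∑ _l : L, (1 + Real.sqrt 2 ^ Module.finrank ℝ (SUNCoords N)) / 2 :=
        Finset.sum_le_sum fun l _ => integral_norm_apply_sunKineticLaw_le N μ l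
    _ = Fintype.card L * ((1 + Real.sqrt 2 ^ Module.finrank ℝ (SUNCoords N)) / 2) := by
        rw [Finset.sum_const, Finset.card_univ, nsmul_eq_mul]

/-- `(Σ_l‖p_l‖)²` is integrable under the engine's refresh law. -/
theorem integrable_sq_sum_norm_sunKineticLaw :
    Integrable (fun p : L → SUNCoords N => (∑ l, ‖p l‖) ^ 2) (sunMomentumLaw (L := L) μ (sunKinetic N)) := by
  have hint2 : Integrable (fun p : L → SUNCoords N => (Fintype.card L : ℝ) * ∑ l, ‖p l‖ ^ 2) (sunMomentumLaw (L := L) μ (sunKinetic N)) :=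
    (integrable_finsetSum _ fun l _ => integrable_norm_apply_sq_sunKineticLaw N μ l).const_mul _
  refine hint2.mono' ((Finset.measurable_sum _ fun l _ => (measurable_pi_apply l).norm).pow_const 2).aestronglyMeasurable
    (Filter.Eventually.of_forall fun p => ?_)
  rw [Real.norm_eq_abs, abs_of_nonneg (sq_nonneg _)]
  have h := sq_sum_le_card_mul_sum_sq (s := Finset.univ) (f := fun l => ‖p l‖)
  simpa only [Finset.card_univ] using h

/-- **`E (Σ_l‖p_l‖)² ≤ |L|²·(√2)^D`** (Cauchy–Schwarz over the links). -/
theorem integral_sq_sum_norm_sunKineticLaw_le :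
    ∫ p, (∑ l, ‖p l‖) ^ 2 ∂(sunMomentumLaw (L := L) μ (sunKinetic N)) ≤
      (Fintype.card L : ℝ) ^ 2 * Real.sqrt 2 ^ Module.finrank ℝ (SUNCoords N) := by
  haveI := isProbabilityMeasure_sunMomentumLaw_sunKinetic N μ (L := L)
  have hint2 : Integrable (fun p : L → SUNCoords N => (Fintype.card L : ℝ) * ∑ l, ‖p l‖ ^ 2) (sunMomentumLaw (L := L) μ (sunKinetic N)) :=
    (integrable_finsetSum _ fun l _ => integrable_norm_apply_sq_sunKineticLaw N μ l).const_mul _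
  have hle : ∀ p : L → SUNCoords N, (∑ l, ‖p l‖) ^ 2 ≤ (Fintype.card L : ℝ) * ∑ l, ‖p l‖ ^ 2 := by
    intro p
    have h := sq_sum_le_card_mul_sum_sq (s := Finset.univ) (f := fun l => ‖p l‖)
    simpa only [Finset.card_univ] using h
  have hD : 0 ≤ Real.sqrt 2 ^ Module.finrank ℝ (SUNCoords N) := by positivity
  calc ∫ p, (∑ l, ‖p l‖) ^ 2 ∂(sunMomentumLaw (L := L) μ (sunKinetic N))
      ≤ ∫ p, (Fintype.card L : ℝ) * ∑ l, ‖p l‖ ^ 2 ∂(sunMomentumLaw (L := L) μ (sunKinetic N)) :=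
        integral_mono (integrable_sq_sum_norm_sunKineticLaw N μ) hint2 hle
    _ = (Fintype.card L : ℝ) * ∑ l, ∫ p, ‖p l‖ ^ 2 ∂(sunMomentumLaw (L := L) μ (sunKinetic N)) := by
        rw [integral_const_mul, integral_finsetSum _ fun l _ => integrable_norm_apply_sq_sunKineticLaw N μ l]
    _ ≤ (Fintype.card L : ℝ) * ∑ _l : L, Real.sqrt 2 ^ Module.finrank ℝ (SUNCoords N) := by
        gcongr with l
        exact integral_norm_apply_sq_sunKineticLaw_le N μ l
    _ = (Fintype.card L : ℝ) ^ 2 * Real.sqrt 2 ^ Module.finrank ℝ (SUNCoords N) := by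
        rw [Finset.sum_const, Finset.card_univ, nsmul_eq_mul]; ring

end Product

end Summit.Ventures.LatticeQCDFlow.Exactness
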